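import Summits.Ventures.HSemireg.WedgeHankelSubstitutionJordanCharP
import Summits.BirchSwinnertonDyer.Rank1Residual.GaloisImage.FiniteSingularComparisonField
import Mathlib.Data.Nat.Factorization.Basic

/-!
# Venture HSemireg — THE NUMBER OF JORDAN BLOCKS OF THE SHEAR ON TH-7's CLASSES IN CHARACTERISTIC `p` IS `⌊n/p⌋ + 1`: `dim ker (SbC(shear λ) − 1) = n / p + 1`
# (`λ ≠ 0`), from `dim V ≤ k · dim ker N` for `N^k = 0` (at least `⌈(n+1)/p⌉` blocks) and a complement of dimension `n − ⌊n/p⌋` meeting the kernel trivially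
# (the spikes `E_i`, `i < n`, `p ∤ i + 1`)

HONEST FRAMING. Part of the Lean index of the computation cell `pub-hsemireg` (seat p10 gen 20, Sunday typer «UNIFORM-IN-n»).
Finite-dimensional EXTERIOR ALGEBRA + linear algebra ONLY: no variety, no cohomology theory, no sheaf, no Ext group, no semiregularity map;
nothing here says that HC / HC_CM / HC_AV holds; no Literature fact is declared or used.  Custodian versions as in `WedgeHankelSiegelIdeal` (1/3) and `WedgeHankelFrameChange`;
the dictionary (translation of the node by `λ` on binary forms of degree `n`; in characteristic `p` its fixed forms are the polynomials in `℘ = ν^p − λ^{p−1}ν` of degree `≤ n`,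
`⌊n/p⌋ + 1` of them) is QUOTED, never asserted.

WHAT IS IN THE TREE.  I18 (`WedgeHankelSubstitutionJordan`): the shear `SbC(1 λ 0 1)` on the class space `spikeSpan n` (`dim = n + 1`), one Jordan block iff `n!·λ^n ≠ 0`;
J3 (`WedgeHankelSubstitutionJordanCharP`): in characteristic `p`, `(SbC(shear λ) − 1)^p = 0` and the largest block has size `min(p, n+1)`; I1 `sbMat_shear_apply` (the Pascal
matrix `C(a,l)·λ^{a−l}`); I11 `toMatrix_SbC`, `spikeBasis`.  THIS FILE (namespace `Summit.Ventures.HSemireg.Wedge.HankelFrameChange` continued; imports J3, the b2b-bsdres lemma file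
`FiniteSingularComparisonField` (for `finrank_ker_pow_le`) and `Mathlib.Data.Nat.Factorization.Basic` (for `Nat.card_multiples`)) counts the blocks:
* §230 the linear-algebra input `dim ker N^k ≤ k · dim ker N` is REUSED from the tree (`Summit.BirchSwinnertonDyer.Rank1Residual.GaloisImage.FSComp.finrank_ker_pow_le`, cell
  `b2b-bsdres`, light imports — the gate's `dedup.landed` rule: import, do not restate); here only the corollary **`finrank_le_mul_finrank_ker_of_pow_eq_zero`** (`N^k = 0 ⇒
  dim V ≤ k · dim ker N`: a nilpotent endomorphism of index `≤ k` has at least `dim V / k` Jordan blocks).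
* §231 coordinates: `repr_SbC_shear_sub_one` (`(S_n(shear) − 1)·c`), **`repr_SbC_shear_sub_one_succ`** (THE PIVOT: if the spike coordinates of `f` vanish below `i₀ < n`, the
  `E_{i₀+1}`-coordinate of `(SbC(shear λ) − 1) f` is `(i₀+1)·λ·c_{i₀}`), hence **`disjoint_ker_SbC_shear_sub_one_span`**: in characteristic `p` (`λ ≠ 0`) the kernel meets
  `span{E_i : i < n, p ∤ i+1}` trivially, and `card_filter_lt_not_dvd_succ` (that index set has `n − ⌊n/p⌋` elements, `Nat.card_multiples`).
* §232 **`succ_le_mul_finrank_ker_SbC_shear_sub_one`** (`n + 1 ≤ p · dim ker`), **`finrank_ker_SbC_shear_sub_one_le`** (`dim ker ≤ ⌊n/p⌋ + 1`), and the count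
  **`finrank_ker_SbC_shear_sub_one_char`: `dim ker (SbC(shear λ) − 1) = n / p + 1` IN CHARACTERISTIC `p`, `λ ≠ 0`** — the shear has exactly `⌊n/p⌋ + 1` Jordan blocks on th-7's
  classes (I8/I18: exactly one when `p > n`); `finrank_ker_SbC_shear_sub_one_charZero` (`= 1` in characteristic `0`).
NOT typed here: the full partition `(p, …, p, n + 1 − p⌊n/p⌋)` (block count + largest block do not pin it in general, e.g. `p = 5`, `n = 12`); anything Ext-side.  New names only.
-/

open Module

namespace Summit.Ventures.HSemireg.Wedge.HankelFrameChange

open Summit.Ventures.HSemireg.Wedge Summit.Ventures.HSemireg.Wedge.Kunneth Summit.Ventures.HSemireg.Wedge.Hankel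
  Summit.Ventures.HSemireg.Wedge.BasisFree Summit.Ventures.HSemireg.Wedge.HankelSiegel Summit.Ventures.HSemireg.Wedge.HankelSiegelIdeal
  Summit.Ventures.HSemireg.Wedge.KunnethKernel Summit.Ventures.HSemireg.Wedge.HankelRankOne Summit.Ventures.HSemireg.Wedge.KernelDuality

variable (K : Type*) [Field K] {n : ℕ}

/-! ## §230. `N^k = 0 ⇒ dim V ≤ k · dim ker N` -/

section KerPow

variable {V : Type*} [AddCommGroup V] [Module K V] [FiniteDimensional K V]

/-- **`N^k = 0 ⇒ dim V ≤ k · dim ker N`**: a nilpotent endomorphism of index `≤ k` has at least `dim V / k` Jordan blocks. -/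
theorem finrank_le_mul_finrank_ker_of_pow_eq_zero {N : V →ₗ[K] V} {k : ℕ} (hN : N ^ k = 0) : finrank K V ≤ k * finrank K ↥(LinearMap.ker N) := by
  have h := Summit.BirchSwinnertonDyer.Rank1Residual.GaloisImage.FSComp.finrank_ker_pow_le N k
  rwa [hN, LinearMap.ker_zero, finrank_top] at h

end KerPow

/-! ## §231. The pivot: the kernel of the shear meets the «free» spikes trivially -/

/-- coordinates of `(SbC(shear λ) − 1) f` in th-7's spike basis: `c′_a = Σ_i (S_n(shear) − 1)_{a,i} c_i`. -/
theorem repr_SbC_shear_sub_one (lam : K) (f : spikeSpan K n) (a : Fin (n + 1)) :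
    (spikeBasis K n).repr ((SbC K 1 lam 0 1 - 1) f) a = ∑ i : Fin (n + 1), (sbMat K 1 lam 0 1 n (n + 1) - 1) a i * (spikeBasis K n).repr f i := by
  have hm : LinearMap.toMatrix (spikeBasis K n) (spikeBasis K n) (SbC K 1 lam 0 1 (n := n) - 1) = sbMat K 1 lam 0 1 n (n + 1) - 1 := by
    have e := map_sub (LinearMap.toMatrix (spikeBasis K n) (spikeBasis K n)) (SbC K 1 lam 0 1 (n := n)) 1
    rw [toMatrix_SbC, LinearMap.toMatrix_one] at e
    exact e
  have h := LinearMap.toMatrix_mulVec_repr (spikeBasis K n) (spikeBasis K n) (SbC K 1 lam 0 1 (n := n) - 1) f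
  rw [← h, hm, Matrix.mulVec_apply_eq_sum]

/-- **THE PIVOT: if the spike coordinates of `f` vanish below `i₀ < n`, the `E_{i₀+1}`-coordinate of `(SbC(shear λ) − 1) f` is `(i₀ + 1)·λ·c_{i₀}`** (the Pascal matrix minus one
is strictly lower triangular with first sub-diagonal `(i+1)·λ`). -/
theorem repr_SbC_shear_sub_one_succ (lam : K) (f : spikeSpan K n) {i₀ : Fin (n + 1)} (hi₀ : (i₀ : ℕ) < n)
    (hvan : ∀ i : Fin (n + 1), (i : ℕ) < i₀ → (spikeBasis K n).repr f i = 0) :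
    (spikeBasis K n).repr ((SbC K 1 lam 0 1 - 1) f) ⟨(i₀ : ℕ) + 1, by omega⟩ = (((i₀ : ℕ) + 1 : ℕ) : K) * lam * (spikeBasis K n).repr f i₀ := by
  rw [repr_SbC_shear_sub_one, Finset.sum_eq_single i₀]
  · rw [Matrix.sub_apply, sbMat_shear_apply, if_pos (by simp), Matrix.one_apply, if_neg (fun h => by have := congrArg Fin.val h; simp at this)]
    simp only [Nat.choose_succ_self_right, Nat.add_sub_cancel_left, pow_one, sub_zero]
  · intro i _ hi
    rcases lt_trichotomy (i : ℕ) (i₀ : ℕ) with hlt | heq | hgt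
    · rw [hvan i hlt, mul_zero]
    · exact absurd (Fin.ext heq) hi
    · rw [Matrix.sub_apply, sbMat_shear_apply, Matrix.one_apply]
      by_cases h : (i : ℕ) = (i₀ : ℕ) + 1
      · have hi' : (⟨(i₀ : ℕ) + 1, by omega⟩ : Fin (n + 1)) = i := Fin.ext h.symm
        rw [if_pos (by simp only; omega), if_pos hi']
        simp only [h, Nat.choose_self, Nat.sub_self, pow_zero, Nat.cast_one, mul_one, sub_self, zero_mul]
      · rw [if_neg (by simp only; omega), if_neg (fun e => h (by rw [← e])), sub_zero, zero_mul]
  · intro h; exact absurd (Finset.mem_univ _) h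

/-- **IN CHARACTERISTIC `p`, `λ ≠ 0`: the kernel of `SbC(shear λ) − 1` meets `span{E_i : i < n, p ∤ i + 1}` trivially** (a non-zero vector of the span has a lowest spike `i₀`
with `p ∤ i₀ + 1`, and then the `E_{i₀+1}`-coordinate of its image is `(i₀+1)·λ·c_{i₀} ≠ 0`). -/
theorem disjoint_ker_SbC_shear_sub_one_span {lam : K} (hlam : lam ≠ 0) (p : ℕ) [Fact p.Prime] [CharP K p] :
    Disjoint (LinearMap.ker (SbC K 1 lam 0 1 (n := n) - 1))
      (Submodule.span K (Set.range fun i : {i : Fin (n + 1) // (i : ℕ) < n ∧ ¬ p ∣ (i : ℕ) + 1} => spikeBasis K n i)) := by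
  rw [Submodule.disjoint_def]
  intro f hker hspan
  by_contra hf
  have hrange : (Set.range fun i : {i : Fin (n + 1) // (i : ℕ) < n ∧ ¬ p ∣ (i : ℕ) + 1} => spikeBasis K n i) =
      spikeBasis K n '' {i : Fin (n + 1) | (i : ℕ) < n ∧ ¬ p ∣ (i : ℕ) + 1} := by
    ext x
    simp only [Set.mem_range, Set.mem_image, Set.mem_setOf_eq, Subtype.exists, exists_prop]
  rw [hrange, Basis.mem_span_image] at hspan
  set c := (spikeBasis K n).repr f with hc
  have hc0 : c.support.Nonempty := by
    rw [Finsupp.support_nonempty_iff]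
    exact fun h => hf ((spikeBasis K n).repr.map_eq_zero_iff.mp h)
  obtain ⟨i₀, hi₀, hmin⟩ := c.support.exists_min_image (fun i => (i : ℕ)) hc0
  have hP : (i₀ : ℕ) < n ∧ ¬ p ∣ (i₀ : ℕ) + 1 := hspan hi₀
  have hvan : ∀ i : Fin (n + 1), (i : ℕ) < i₀ → c i = 0 := fun i hi => by
    by_contra hne
    exact absurd (hmin i (Finsupp.mem_support_iff.mpr hne)) (not_le.mpr hi)
  have key := repr_SbC_shear_sub_one_succ K lam f hP.1 hvan
  rw [LinearMap.mem_ker.mp hker, map_zero, Finsupp.zero_apply, eq_comm] at key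
  rcases mul_eq_zero.mp key with h | h
  · rcases mul_eq_zero.mp h with h' | h'
    · exact hP.2 ((CharP.cast_eq_zero_iff K p _).mp h')
    · exact hlam h'
  · exact Finsupp.mem_support_iff.mp hi₀ h

/-- the index count: `#{i ≤ n : i < n ∧ p ∤ i + 1} = n − ⌊n/p⌋` (`Nat.card_multiples`). -/
theorem card_filter_lt_not_dvd_succ (n p : ℕ) :
    (Finset.univ.filter fun i : Fin (n + 1) => (i : ℕ) < n ∧ ¬ p ∣ (i : ℕ) + 1).card = n - n / p := by
  have hmap : (Finset.univ.filter fun i : Fin (n + 1) => (i : ℕ) < n ∧ ¬ p ∣ (i : ℕ) + 1).map Fin.valEmbedding =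
      (Finset.range n).filter fun e => ¬ p ∣ e + 1 := by
    ext e
    simp only [Finset.mem_map, Finset.mem_filter, Finset.mem_univ, true_and, Fin.valEmbedding_apply, Finset.mem_range]
    constructor
    · rintro ⟨i, ⟨hi, hpi⟩, rfl⟩; exact ⟨hi, hpi⟩
    · rintro ⟨he, hpe⟩; exact ⟨⟨e, by omega⟩, ⟨he, hpe⟩, rfl⟩
  rw [← Finset.card_map Fin.valEmbedding, hmap]
  have h2 := Finset.card_filter_add_card_filter_not (s := Finset.range n) (fun e => p ∣ e + 1)
  rw [Nat.card_multiples, Finset.card_range] at h2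
  omega

/-! ## §232. The count of Jordan blocks -/

/-- **AT LEAST `⌈(n+1)/p⌉` BLOCKS: `n + 1 ≤ p · dim ker (SbC(shear λ) − 1)`** in characteristic `p` (every `λ`; J3 `(SbC(shear λ) − 1)^p = 0` + §230). -/
theorem succ_le_mul_finrank_ker_SbC_shear_sub_one (lam : K) (p : ℕ) [Fact p.Prime] [CharP K p] :
    n + 1 ≤ p * finrank K ↥(LinearMap.ker (SbC K 1 lam 0 1 (n := n) - 1)) := by
  have h := finrank_le_mul_finrank_ker_of_pow_eq_zero K (SbC_shear_sub_one_pow_char K lam p (n := n))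
  rwa [finrank_eq_card_basis (spikeBasis K n), Fintype.card_fin] at h

/-- **AT MOST `⌊n/p⌋ + 1` BLOCKS: `dim ker (SbC(shear λ) − 1) ≤ n / p + 1`** in characteristic `p`, `λ ≠ 0` (§231: a complement of dimension `n − ⌊n/p⌋` misses the kernel). -/
theorem finrank_ker_SbC_shear_sub_one_le {lam : K} (hlam : lam ≠ 0) (p : ℕ) [Fact p.Prime] [CharP K p] :
    finrank K ↥(LinearMap.ker (SbC K 1 lam 0 1 (n := n) - 1)) ≤ n / p + 1 := by
  classical
  have hW : finrank K ↥(Submodule.span K (Set.range fun i : {i : Fin (n + 1) // (i : ℕ) < n ∧ ¬ p ∣ (i : ℕ) + 1} => spikeBasis K n i)) = n - n / p := by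
    have hli : LinearIndependent K fun i : {i : Fin (n + 1) // (i : ℕ) < n ∧ ¬ p ∣ (i : ℕ) + 1} => spikeBasis K n i :=
      (spikeBasis K n).linearIndependent.comp (fun i : {i : Fin (n + 1) // (i : ℕ) < n ∧ ¬ p ∣ (i : ℕ) + 1} => (i : Fin (n + 1))) Subtype.val_injective
    rw [finrank_span_eq_card hli, Fintype.card_subtype, card_filter_lt_not_dvd_succ]
  have h := Submodule.finrank_add_finrank_le_of_disjoint (disjoint_ker_SbC_shear_sub_one_span K (n := n) hlam p)
  rw [hW, finrank_eq_card_basis (spikeBasis K n), Fintype.card_fin] at h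
  have : n / p ≤ n := Nat.div_le_self n p
  omega

/-- **THE SHEAR HAS EXACTLY `⌊n/p⌋ + 1` JORDAN BLOCKS ON TH-7's CLASSES IN CHARACTERISTIC `p`: `dim ker (SbC(shear λ) − 1) = n / p + 1`** (`λ ≠ 0`; with J3: the largest has
size `min(p, n+1)`; with I8/I18: exactly one block when `p > n`). -/
theorem finrank_ker_SbC_shear_sub_one_char {lam : K} (hlam : lam ≠ 0) (p : ℕ) [Fact p.Prime] [CharP K p] :
    finrank K ↥(LinearMap.ker (SbC K 1 lam 0 1 (n := n) - 1)) = n / p + 1 := by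
  have hp : p.Prime := Fact.out
  have h1 := succ_le_mul_finrank_ker_SbC_shear_sub_one K lam p (n := n)
  have h2 := finrank_ker_SbC_shear_sub_one_le K (n := n) hlam p
  -- from `n + 1 ≤ p·d`: `n / p < d`
  have h3 : n / p < finrank K ↥(LinearMap.ker (SbC K 1 lam 0 1 (n := n) - 1)) := by
    rw [Nat.div_lt_iff_lt_mul hp.pos]
    linarith [Nat.mul_comm p (finrank K ↥(LinearMap.ker (SbC K 1 lam 0 1 (n := n) - 1)))]
  omega

/-- characteristic `0`: `dim ker (SbC(shear λ) − 1) = 1` for `λ ≠ 0` — ONE Jordan block (I8's unique eigen-class, now counted): the pivot §231 applies to EVERY `i < n`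
(`i + 1 ≠ 0` in `K`), so the span of `E_0, …, E_{n−1}` misses the kernel, while the point class `E_n` is fixed. -/
theorem finrank_ker_SbC_shear_sub_one_charZero [CharZero K] {lam : K} (hlam : lam ≠ 0) :
    finrank K ↥(LinearMap.ker (SbC K 1 lam 0 1 (n := n) - 1)) = 1 := by
  classical
  -- the span of ALL `E_i`, `i < n`, misses the kernel (every `i + 1 ≠ 0` in `K`), so `dim ker ≤ 1`; and `E_n` is fixed, so `dim ker ≥ 1`
  have hdisj : Disjoint (LinearMap.ker (SbC K 1 lam 0 1 (n := n) - 1))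
      (Submodule.span K (Set.range fun i : {i : Fin (n + 1) // (i : ℕ) < n} => spikeBasis K n i)) := by
    rw [Submodule.disjoint_def]
    intro f hker hspan
    by_contra hf
    have hrange : (Set.range fun i : {i : Fin (n + 1) // (i : ℕ) < n} => spikeBasis K n i) = spikeBasis K n '' {i : Fin (n + 1) | (i : ℕ) < n} := by
      ext x
      simp only [Set.mem_range, Set.mem_image, Set.mem_setOf_eq, Subtype.exists, exists_prop]
    rw [hrange, Basis.mem_span_image] at hspan
    set c := (spikeBasis K n).repr f with hc
    have hc0 : c.support.Nonempty := by
      rw [Finsupp.support_nonempty_iff]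
      exact fun h => hf ((spikeBasis K n).repr.map_eq_zero_iff.mp h)
    obtain ⟨i₀, hi₀, hmin⟩ := c.support.exists_min_image (fun i => (i : ℕ)) hc0
    have hP : (i₀ : ℕ) < n := hspan hi₀
    have hvan : ∀ i : Fin (n + 1), (i : ℕ) < i₀ → c i = 0 := fun i hi => by
      by_contra hne
      exact absurd (hmin i (Finsupp.mem_support_iff.mpr hne)) (not_le.mpr hi)
    have key := repr_SbC_shear_sub_one_succ K lam f hP hvan
    rw [LinearMap.mem_ker.mp hker, map_zero, Finsupp.zero_apply, eq_comm] at key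
    rcases mul_eq_zero.mp key with h | h
    · rcases mul_eq_zero.mp h with h' | h'
      · exact Nat.cast_ne_zero.mpr (Nat.succ_ne_zero _) h'
      · exact hlam h'
    · exact Finsupp.mem_support_iff.mp hi₀ h
  have hW : finrank K ↥(Submodule.span K (Set.range fun i : {i : Fin (n + 1) // (i : ℕ) < n} => spikeBasis K n i)) = n := by
    have hli : LinearIndependent K fun i : {i : Fin (n + 1) // (i : ℕ) < n} => spikeBasis K n i :=
      (spikeBasis K n).linearIndependent.comp (fun i : {i : Fin (n + 1) // (i : ℕ) < n} => (i : Fin (n + 1))) Subtype.val_injective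
    rw [finrank_span_eq_card hli, Fintype.card_subtype]
    have hmap : (Finset.univ.filter fun i : Fin (n + 1) => (i : ℕ) < n).map Fin.valEmbedding = Finset.range n := by
      ext e
      simp only [Finset.mem_map, Finset.mem_filter, Finset.mem_univ, true_and, Fin.valEmbedding_apply, Finset.mem_range]
      constructor
      · rintro ⟨i, hi, rfl⟩; exact hi
      · intro he; exact ⟨⟨e, by omega⟩, he, rfl⟩
    rw [← Finset.card_map Fin.valEmbedding, hmap, Finset.card_range]
  have h := Submodule.finrank_add_finrank_le_of_disjoint hdisj
  rw [hW, finrank_eq_card_basis (spikeBasis K n), Fintype.card_fin] at h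
  -- lower bound: the point class `E_n` is fixed (`SbC_shear_sub_one_pow_self_apply_w` with `n = ` … simpler: I18 `SbC_shear_sub_one_pow_ne_zero` at `k = 0`? use the eigenvalue)
  have hle : finrank K ↥(LinearMap.ker (SbC K 1 lam 0 1 (n := n) - 1)) ≤ 1 := by omega
  refine le_antisymm hle ?_
  -- `E_n ∈ ker`: the point class is fixed by the shear
  have hE : (⟨w K n n (fun j => if j = n then (1 : K) else 0), w_mem_spikeSpan K _⟩ : spikeSpan K n) ∈ LinearMap.ker (SbC K 1 lam 0 1 (n := n) - 1) := by
    rw [LinearMap.mem_ker, LinearMap.sub_apply, Module.End.one_apply, sub_eq_zero]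
    apply Subtype.ext
    rw [SbC_apply_coe]
    exact (Sb_w_point_of_upper K 1 lam 1 le_rfl).trans (by rw [one_pow, one_smul])
  have hne : (⟨w K n n (fun j => if j = n then (1 : K) else 0), w_mem_spikeSpan K _⟩ : spikeSpan K n) ≠ 0 :=
    fun h => w_spike_ne_zero K le_rfl (congrArg Subtype.val h)
  rw [Nat.one_le_iff_ne_zero, Ne, Submodule.finrank_eq_zero]
  exact fun h => hne ((Submodule.mem_bot K).mp (h ▸ hE))

end Summit.Ventures.HSemireg.Wedge.HankelFrameChange
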